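import Mathlib
import Summits.PneNP.PneNP.Theorems.OverlapGapAlgebraNoStableSectionDefs
import Summits.PneNP.PneNP.Theorems.OverlapGapAlgebraNoStableSectionEnergyAux
import Summits.PneNP.PneNP.Theorems.OverlapGapAlgebraNoStableSectionEnergyFA

/-!
# Route OverlapGapAlgebra, crux `NoStableSection` (stmt-PneNP-2462), line `DartGame`:
# stub `stub_energyBound` (the energy bound, BH Prop. 5.2 via first appearance + small ball)

`stub_energyBound` : for `k + 1` rungs `Y 0, …, Y k : Fin n → Bool` whose conditional type
entropies `condEnt Y ℓ`, `1 ≤ ℓ ≤ k`, are all `≥ b ≥ 2θ` (`0 < θ < 1`),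
`energySum Y k / n^k ≥ 1 + k (1 - SB(p₀)) - θ k(k+1)/2` with `SB(p) = 2(1-p)^k + k p (1-p)^(k-1)`
and `p₀ = (b - 2θ)/(-log θ)` (Bresler–Huang arXiv:2106.02129 Prop. 5.2, with Props 5.5–5.7 replaced
by first appearance + truncation at level `θ` + a Markov bound + the small-ball lemma
`dartGameSmallBall` of `OverlapGapAlgebraNoStableSectionSmallBall`).

The abstract per-rung bound `en_rung_abstract` (`#{I new at rung ℓ} ≥ n^k (1 - SB(p₀) - ℓ θ)` for
weights `φ : Fin n → (0,1]` with `∑ -log φ ≥ n b`, `∑ 1/φ ≤ 2n`, `∑_{Y ℓ i = Y ℓ' i} 1/φ ≤ n`) is in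
`OverlapGapAlgebraNoStableSectionEnergyAux`; the position sums feeding it (with `φ i = M i / N i`, the
conditional frequency of the bit `Y ℓ i` within the class of `i`) and FIRST APPEARANCE
(`n^k + ∑_{ℓ=1}^k #{I : rung ℓ of I is new} ≤ energySum Y k`) are in
`OverlapGapAlgebraNoStableSectionEnergyFA`.  Here: the per-rung instantiation `en_rung` and the sum
over `ℓ = 1, …, k`.
-/

namespace Summit.PneNP.PneNP.Cruxes.NoStableSection.DartGame
set_option linter.dupNamespace false

open Finset Real

variable {n : ℕ}

/-- **Per-rung bound**: for `b ≤ condEnt Y ℓ`,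
`#{I : the rung-ℓ pattern of I is new} ≥ n^k (1 - SB(p₀) - ℓ θ)`. -/
theorem en_rung {k : ℕ} (Y : ℕ → Fin n → Bool) (ℓ : ℕ) {θ b : ℝ} (hn : 1 ≤ n) (hθ : 0 < θ)
    (hθ1 : θ < 1) (hb : 2 * θ ≤ b) (hcond : b ≤ condEnt Y ℓ) :
    (n : ℝ) ^ k * (1 - (2 * (1 - (b - 2 * θ) / (-Real.log θ)) ^ k +
        k * ((b - 2 * θ) / (-Real.log θ)) * (1 - (b - 2 * θ) / (-Real.log θ)) ^ (k - 1)) -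
          ℓ * θ) ≤
      ((univ.filter fun I : Fin k → Fin n =>
        ∀ ℓ' < ℓ, ¬ ∀ r, Y ℓ (I r) = Y ℓ' (I r)).card : ℝ) := by
  have hnr : (0 : ℝ) < n := by exact_mod_cast hn
  refine en_rung_abstract ℓ Y
    (fun i => (patCount Y (ℓ + 1) (fun j : Fin (ℓ + 1) => Y j i) : ℝ) /
      patCount Y ℓ (fun j : Fin ℓ => Y j i)) ?_ ?_ hθ hθ1 hb hn ?_
    (en_sum_inv_ratio_le Y ℓ) (fun ℓ' hℓ' => en_sum_inv_ratio_filter_le Y ℓ hℓ')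
  · exact fun i => div_pos (by exact_mod_cast en_patCount_self_pos Y (ℓ + 1) i)
      (by exact_mod_cast en_patCount_self_pos Y ℓ i)
  · exact fun i => div_le_one_of_le₀ (by exact_mod_cast en_patCount_succ_le_self Y ℓ i)
      (Nat.cast_nonneg _)
  · calc (n : ℝ) * b ≤ n * condEnt Y ℓ := mul_le_mul_of_nonneg_left hcond hnr.le
      _ = _ := (en_sum_neglog_ratio Y ℓ hn).symm

/-- **Stub En — the energy bound** (registered as `stub_energyBound : EnergyBound` in the line's
skeleton): for `k + 1` rungs `Y 0, …, Y k` whose conditional type entropies at rungs `1, …, k` are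
all `≥ b ≥ 2θ`, the normalised energy `E_I |{(Y ℓ ∘ I) : ℓ ≤ k}| = energySum Y k / n^k` is at
least `1 + k (1 - SB(p₀)) - θ k(k+1)/2`, `SB(p) = 2(1-p)^k + k p (1-p)^(k-1)`,
`p₀ = (b - 2θ)/(-log θ)`.  Proof: first appearance + the per-rung bound `en_rung`
(truncation at level `θ`, Markov, and the small-ball lemma `dartGameSmallBall`). -/
theorem stub_energyBound :
  ∀ (n k : ℕ) (Y : ℕ → Fin n → Bool) (θ b p₀ : ℝ), 1 ≤ n → 1 ≤ k → 0 < θ → θ < 1 →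
    2 * θ ≤ b → p₀ = (b - 2 * θ) / (-Real.log θ) →
    (∀ ℓ, 1 ≤ ℓ → ℓ ≤ k → b ≤ condEnt Y ℓ) →
    (1 : ℝ) + k * (1 - (2 * (1 - p₀) ^ k + k * p₀ * (1 - p₀) ^ (k - 1))) -
        θ * ((k : ℝ) * (k + 1) / 2) ≤ (energySum Y k : ℝ) / (n : ℝ) ^ k := by
  intro n k Y θ b p₀ hn _hk hθ hθ1 hb hp₀ hcond
  have hnr : (0 : ℝ) < n := by exact_mod_cast hn
  have hnk : (0 : ℝ) < (n : ℝ) ^ k := pow_pos hnr k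
  rw [le_div_iff₀ hnk]
  subst hp₀
  set A : ℝ := 2 * (1 - (b - 2 * θ) / (-Real.log θ)) ^ k +
    k * ((b - 2 * θ) / (-Real.log θ)) * (1 - (b - 2 * θ) / (-Real.log θ)) ^ (k - 1) with hA
  -- the per-rung bounds, summed over `ℓ = j + 1`, `j < k`
  have hsum : ∑ j : Fin k, (n : ℝ) ^ k * (1 - A - (((j : ℕ) + 1 : ℕ) : ℝ) * θ) ≤
      ∑ j : Fin k, ((univ.filter fun I : Fin k → Fin n =>
        ∀ ℓ' < (j : ℕ) + 1, ¬ ∀ r, Y ((j : ℕ) + 1) (I r) = Y ℓ' (I r)).card : ℝ) :=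
    Finset.sum_le_sum fun j _ =>
      en_rung Y ((j : ℕ) + 1) hn hθ hθ1 hb (hcond _ (by omega) (by omega))
  rw [← Finset.mul_sum, en_sum_fin_linear] at hsum
  -- first appearance
  have hfa : (n : ℝ) ^ k + ∑ j : Fin k, ((univ.filter fun I : Fin k → Fin n =>
      ∀ ℓ' < (j : ℕ) + 1, ¬ ∀ r, Y ((j : ℕ) + 1) (I r) = Y ℓ' (I r)).card : ℝ) ≤
      (energySum Y k : ℝ) := by
    exact_mod_cast en_sum_card_new_le_energySum Y
  calc (1 + k * (1 - A) - θ * ((k : ℝ) * (k + 1) / 2)) * (n : ℝ) ^ k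
      = (n : ℝ) ^ k + (n : ℝ) ^ k * (k * (1 - A) - θ * ((k : ℝ) * (k + 1) / 2)) := by ring
    _ ≤ (energySum Y k : ℝ) := by linarith

end Summit.PneNP.PneNP.Cruxes.NoStableSection.DartGame
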